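import Literature.Dynamics.Homogeneous.OrthogonalGroupOrbitClosuresK3Plane
import HarnessLib

/-!
# Eichler transvections and transitivity on frames of `Λ_{K3} ⊗ ℝ` by unipotent isometries

Topic `Literature/Dynamics/Homogeneous`; one auxiliary notion (`eichlerGens`, the set of Eichler
transvections orthogonal to a set of vectors, with proved API) and theorems — no named fact
(D-0026) — on top of `OrthogonalGroupOrbitClosuresK3Plane` / `…Unipotents`. This is glue step (4),
TRANSITIVITY, of the Ratner-theoretic proof of
`Literature.Dynamics.Homogeneous.Verbitsky2017_orbitClosure_trichotomy_K3`
[Verbitsky2017ErgodicErratum, §2.3]: once Ratner's theorem produces a closed subgroup `P` of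
`SO(Λ_{K3} ⊗ ℝ)` through which the orbit closure of the frame `(Re x, Im x)` of a period point
factors, one needs that `P` MOVES the frame of `x` to the frame of every admissible `y`; in the
two non-rational cases of the erratum (`P = G = SO⁺(3,19)`, resp. `P ⊇ SO⁺(v₀^⊥)`), `P` contains
all Eichler transvections (resp. all those orthogonal to `v₀`), and this file proves that these
unipotent isometries already act transitively on the relevant frames. Everything is stated in the
LC-agnostic form "there is a product of Eichler transvections (orthogonal to `S`) mapping the frame
of `x` to the frame of `y`", so that it applies to any group containing the generators.

* Field-general part (`section Eichler`, any field with `2 ≠ 0`, symmetric `B`): the Eichler map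
  `T_{u,w} : y ↦ B(u,y) w − B(w,y) u` for `u` isotropic and `w ⊥ u` is cube-zero
  (`eichlerT_pow_three`), the transvection `E_{u,w} = 1 + T + ½T²` (`= u_N(1)` for the cube-zero
  skew `N = T_{u,w}` of `…Unipotents`, i.e. `exp T`) is an isometry fixing `⟨u, w⟩^⊥`
  (`B_apply_of_mem_eichlerGens`, `eichler_apply_of_orthogonal`), its fixed vectors / centralizer
  are those of `T` (`eichler_apply_eq_self_iff`, `commute_eichler_iff`), and the ONE-STEP TRANSPORT
  `eichler_transport`: if `(v.v) = (v'.v')`, `u` is isotropic with `(u.v) = (u.v') ≠ 0` and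
  `w₀ = (v' − v)/(u.v)`, then `E_{u,w₀} v = v'` (classical, Eichler 1952 / O'Meara §55; the
  coefficient of `u` vanishes exactly because the squares agree). `eichlerGens B S` is the set of
  `E_{u,w}` with `u, w ⊥ S`; products of its elements are isometries fixing `S` pointwise.
* `Λ_{K3} ⊗ ℝ ≅ ℝ^{3,19}` (`section K3Transport`): explicit definite `3`-spaces
  (`k3_exists_definite_threeSpaces`: `⟨e_k ± f_k⟩ ⊂ U^{⊕3}`), hence positive AND negative vectors
  in every subspace of dimension `≥ 20` (`k3_exists_pos_neg_mem`); two isotropic points on an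
  indefinite pencil (`exists_two_isotropic_of_sign`); the EXISTENCE OF ISOTROPIC TRANSPORTERS
  `k3_exists_isotropic_transporter` (for `v' ≠ ±v` of the same positive square, both `⊥ z` with
  `z` anisotropic or zero, some isotropic `u ⊥ z` has `(u.v) = (u.v') ≠ 0` — otherwise `v` would be
  orthogonal to all of `⟨z, v − v'⟩^⊥`); transport of a positive vector by at most two
  transvections orthogonal to `z` (`k3_exists_mem_closure_eichlerGens_apply_eq`; the antipode
  through an auxiliary positive vector); TRANSITIVITY ON FRAMES
  (`k3_exists_mem_closure_eichlerGens_frame`: move `R ↦ R'`, then the image of `I` to `I'` inside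
  the stabiliser of `R'`) and ON FRAMES THROUGH A COMMON VECTOR `v₀ = a R + b I = a R' + b I'`
  by transvections FIXING `v₀` (`k3_exists_mem_closure_eichlerGens_frame_fixing`: transport the
  companion `−b R + a I`); the period-domain forms `k3Period_exists_mem_closure_eichlerGens_frame`
  (`x, y ∈ D`, `(Re x)² = (Re y)²`) and `…_frame_fixing`; and the rank-one companion of the
  Fix-computation of `…K3Plane`: the common kernel of the `T_{u,w}` orthogonal to a positive `v₀`
  is the line `ℝ v₀` (`k3_forall_eichlerT_apply_eq_zero_iff`), i.e. the common fixed space of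
  `SO⁺(v₀^⊥)`'s Eichler transvections is `ℝ v₀` — the input of the Borel-density step in the
  intermediate case of the erratum.

## References

* [Verbitsky2017ErgodicErratum] M. Verbitsky, Ergodic complex structures on hyperkähler manifolds:
  an erratum, arXiv:1708.05802 (2017), §2.3 (proof of the Theorem: the three possible Ratner
  groups and what their orbits are), §2.2 (`H`, `G` generated by unipotents).
* [Huybrechts2016K3] D. Huybrechts, Lectures on K3 Surfaces, CUP 2016, Ch. 14 §0.3 (vi)
  (`Λ_{K3} ≅ U^{⊕3} ⊕ E₈(−1)^{⊕2}`, signature `(3,19)`), Ch. 6 Prop. 1.5 (frames of period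
  points: `Re x ⊥ Im x`, `(Re x)² = (Im x)² > 0`).
-/

noncomputable section

namespace Literature.Dynamics.Homogeneous

open Module
open scoped Matrix
open Literature.AlgebraicGeometry Literature.AlgebraicGeometry.Surfaces

/-! ### Eichler transvections `E_{u,w} = 1 + T + ½T²`, `T y = (u.y) w − (w.y) u` (`u` isotropic,
`w ⊥ u`): one-step transport of vectors of equal length -/

section Eichler

variable {𝕜 : Type*} [Field 𝕜] {V : Type*} [AddCommGroup V] [Module 𝕜 V]
  {B : LinearMap.BilinForm 𝕜 V}

/-- The Eichler map `T_{u,w} : y ↦ B(u,y) w − B(w,y) u` applied. [folklore] -/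
theorem eichlerT_apply (u w y : V) :
    (LinearMap.smulRight (B u) w - LinearMap.smulRight (B w) u : Module.End 𝕜 V) y =
      B u y • w - B w y • u := rfl

/-- `T_{u,w}` kills `u` (for `u` isotropic, `w ⊥ u`). [folklore] -/
theorem eichlerT_apply_self (hB : B.IsSymm) {u w : V} (huu : B u u = 0) (huw : B u w = 0) :
    (LinearMap.smulRight (B u) w - LinearMap.smulRight (B w) u : Module.End 𝕜 V) u = 0 := by
  rw [eichlerT_apply, huu, show B w u = 0 by rw [hB.eq]; exact huw, zero_smul, zero_smul, sub_zero]

/-- `T_{u,w} w = −B(w,w) u`. [folklore] -/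
theorem eichlerT_apply_right {u w : V} (huw : B u w = 0) :
    (LinearMap.smulRight (B u) w - LinearMap.smulRight (B w) u : Module.End 𝕜 V) w =
      -(B w w) • u := by
  rw [eichlerT_apply, huw, zero_smul, zero_sub, neg_smul]

/-- `T_{u,w}` kills every vector orthogonal to `u` and `w`. [folklore] -/
theorem eichlerT_apply_of_orthogonal {u w y : V} (huy : B u y = 0) (hwy : B w y = 0) :
    (LinearMap.smulRight (B u) w - LinearMap.smulRight (B w) u : Module.End 𝕜 V) y = 0 := by
  rw [eichlerT_apply, huy, hwy, zero_smul, zero_smul, sub_zero]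

/-- **The Eichler transvection fixes the common orthogonal of `u`, `w`.** [folklore] -/
theorem eichler_apply_of_orthogonal {u w y : V} (huy : B u y = 0) (hwy : B w y = 0) (t a : 𝕜) :
    ((1 : Module.End 𝕜 V) + t • (LinearMap.smulRight (B u) w - LinearMap.smulRight (B w) u) +
      a • ((LinearMap.smulRight (B u) w - LinearMap.smulRight (B w) u) *
        (LinearMap.smulRight (B u) w - LinearMap.smulRight (B w) u))) y = y := by
  simp only [LinearMap.add_apply, LinearMap.smul_apply, Module.End.one_apply, Module.End.mul_apply,
    eichlerT_apply_of_orthogonal huy hwy, map_zero, smul_zero, add_zero]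

/-- **One-step transport by an Eichler transvection.** Let `B` be symmetric, `B(v,v) = B(v',v')`,
`u` isotropic with `B(u, v − v') = 0` and `B(u,v) ≠ 0`, and `B(u,v) w₀ = v' − v` (so
`w₀ = B(u,v)⁻¹ (v' − v) ⊥ u`). Then the transvection `E = 1 + T + ½T²`, `T = T_{u,w₀}`, maps `v` to
`v'`: `E v = v + B(u,v) w₀ − (B(w₀,v) + ½B(u,v)B(w₀,w₀)) u = v'`, the coefficient of `u` vanishing
exactly because `(v.v) = (v'.v')`. (`E = u_N(−1)` for the cube-zero `N = u ∧ w₀` of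
`…Unipotents`, an isometry.) [folklore] -/
theorem eichler_transport [NeZero (2 : 𝕜)] (hB : B.IsSymm) {u v v' w₀ : V} (huu : B u u = 0)
    (huv : B u v ≠ 0) (hud : B u v = B u v') (hvv : B v v = B v' v')
    (hw₀ : B u v • w₀ = v' - v) :
    ((1 : Module.End 𝕜 V) + (LinearMap.smulRight (B u) w₀ - LinearMap.smulRight (B w₀) u) +
      (2⁻¹ : 𝕜) • ((LinearMap.smulRight (B u) w₀ - LinearMap.smulRight (B w₀) u) *
        (LinearMap.smulRight (B u) w₀ - LinearMap.smulRight (B w₀) u))) v = v' := by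
  have h2 : (2 : 𝕜) ≠ 0 := two_ne_zero
  have hk : B u v * (B u v)⁻¹ = 1 := mul_inv_cancel₀ huv
  have hw₀' : w₀ = (B u v)⁻¹ • (v' - v) := by
    rw [← hw₀, smul_smul, inv_mul_cancel₀ huv, one_smul]
  have huw₀ : B u w₀ = 0 := by
    rw [hw₀', map_smul, smul_eq_mul, map_sub, ← hud, sub_self, mul_zero]
  have hvu : B v u = B u v := hB.eq v u
  have hv'v : B v' v = B v v' := hB.eq v' v
  -- `T v` and `T (T v)`
  have hTv : (LinearMap.smulRight (B u) w₀ - LinearMap.smulRight (B w₀) u : Module.End 𝕜 V) v =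
      B u v • w₀ - B w₀ v • u := rfl
  have hTTv : (LinearMap.smulRight (B u) w₀ - LinearMap.smulRight (B w₀) u : Module.End 𝕜 V)
      ((LinearMap.smulRight (B u) w₀ - LinearMap.smulRight (B w₀) u : Module.End 𝕜 V) v) =
      -(B u v * B w₀ w₀) • u := by
    rw [hTv, map_sub, LinearMap.map_smul_of_tower, LinearMap.map_smul_of_tower,
      eichlerT_apply_self hB huu huw₀, smul_zero, sub_zero, eichlerT_apply_right huw₀]
    module
  rw [LinearMap.add_apply, LinearMap.add_apply, LinearMap.smul_apply, Module.End.one_apply,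
    Module.End.mul_apply, hTTv, hTv, hw₀]
  -- the coefficient of `u`
  have e1 : B w₀ v = (B u v)⁻¹ * (B v v' - B v v) := by
    rw [hw₀']
    simp only [map_smul, LinearMap.smul_apply, smul_eq_mul, map_sub, LinearMap.sub_apply, hv'v]
  have e2 : B w₀ w₀ = (B u v)⁻¹ * ((B u v)⁻¹ * (B v' v' - B v v' - (B v v' - B v v))) := by
    rw [hw₀']
    simp only [map_smul, LinearMap.smul_apply, smul_eq_mul, map_sub, LinearMap.sub_apply, hv'v]
    ring
  have hcoef2 : 2 * B w₀ v + B u v * B w₀ w₀ = 0 := by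
    rw [e1, e2]
    linear_combination (-(B u v)⁻¹) * hvv + ((B u v)⁻¹ * (B v' v' - 2 * B v v' + B v v)) * hk
  have hcoef : B w₀ v + 2⁻¹ * (B u v * B w₀ w₀) = 0 := by
    have h22 : (2⁻¹ : 𝕜) * 2 = 1 := inv_mul_cancel₀ h2
    have : B w₀ v + 2⁻¹ * (B u v * B w₀ w₀) = 2⁻¹ * (2 * B w₀ v + B u v * B w₀ w₀) := by
      linear_combination (-(B w₀ v)) * h22
    rw [this, hcoef2, mul_zero]
  have : v + (v' - v - B w₀ v • u) + (2⁻¹ : 𝕜) • (-(B u v * B w₀ w₀) • u) =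
      v' - (B w₀ v + 2⁻¹ * (B u v * B w₀ w₀)) • u := by
    module
  rw [this, hcoef, zero_smul, sub_zero]


/-- `T_{u,w}³ = 0` for `u` isotropic, `w ⊥ u` (so `E = 1 + T + ½T² = exp T`). [folklore] -/
theorem eichlerT_pow_three (hB : B.IsSymm) {u w : V} (huu : B u u = 0) (huw : B u w = 0) :
    (LinearMap.smulRight (B u) w - LinearMap.smulRight (B w) u : Module.End 𝕜 V) ^ 3 = 0 := by
  ext y
  have hTT : (LinearMap.smulRight (B u) w - LinearMap.smulRight (B w) u : Module.End 𝕜 V)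
      ((LinearMap.smulRight (B u) w - LinearMap.smulRight (B w) u : Module.End 𝕜 V) y) =
      -(B u y * B w w) • u := by
    rw [eichlerT_apply u w y, map_sub, LinearMap.map_smul_of_tower, LinearMap.map_smul_of_tower,
      eichlerT_apply_self hB huu huw, smul_zero, sub_zero, eichlerT_apply_right huw]
    module
  rw [pow_three, Module.End.mul_apply, Module.End.mul_apply, hTT, LinearMap.map_smul_of_tower,
    eichlerT_apply_self hB huu huw, smul_zero, LinearMap.zero_apply]


/-- **Fixed vectors of an Eichler transvection**: `E_{u,w} y = y` iff `T_{u,w} y = 0`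
(`E = u_N(1)`, `SkewPlane.unipotent_apply_eq_self_iff`). [folklore] -/
theorem eichler_apply_eq_self_iff (hB : B.IsSymm) {u w : V} (huu : B u u = 0) (huw : B u w = 0)
    (y : V) :
    ((1 : Module.End 𝕜 V) + (LinearMap.smulRight (B u) w - LinearMap.smulRight (B w) u) +
      (2⁻¹ : 𝕜) • ((LinearMap.smulRight (B u) w - LinearMap.smulRight (B w) u) *
        (LinearMap.smulRight (B u) w - LinearMap.smulRight (B w) u))) y = y ↔
    (LinearMap.smulRight (B u) w - LinearMap.smulRight (B w) u : Module.End 𝕜 V) y = 0 := by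
  have h := SkewPlane.unipotent_apply_eq_self_iff (eichlerT_pow_three hB huu huw) (t := (1 : 𝕜))
    one_ne_zero y
  simpa only [one_smul, one_pow, one_mul] using h

/-- **Centralizer of an Eichler transvection**: `X` commutes with `E_{u,w}` iff it commutes with
`T_{u,w}` (`SkewPlane.commute_unipotent_iff`). [folklore] -/
theorem commute_eichler_iff [NeZero (2 : 𝕜)] (hB : B.IsSymm) {u w : V} (huu : B u u = 0)
    (huw : B u w = 0) (X : Module.End 𝕜 V) :
    X * ((1 : Module.End 𝕜 V) + (LinearMap.smulRight (B u) w - LinearMap.smulRight (B w) u) +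
      (2⁻¹ : 𝕜) • ((LinearMap.smulRight (B u) w - LinearMap.smulRight (B w) u) *
        (LinearMap.smulRight (B u) w - LinearMap.smulRight (B w) u))) =
      ((1 : Module.End 𝕜 V) + (LinearMap.smulRight (B u) w - LinearMap.smulRight (B w) u) +
      (2⁻¹ : 𝕜) • ((LinearMap.smulRight (B u) w - LinearMap.smulRight (B w) u) *
        (LinearMap.smulRight (B u) w - LinearMap.smulRight (B w) u))) * X ↔
    X * (LinearMap.smulRight (B u) w - LinearMap.smulRight (B w) u) =
      (LinearMap.smulRight (B u) w - LinearMap.smulRight (B w) u) * X := by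
  have h := SkewPlane.commute_unipotent_iff (eichlerT_pow_three hB huu huw) (t := (1 : 𝕜))
    one_ne_zero X
  simpa only [one_smul, one_pow, one_mul] using h

/-- The Eichler transvections `E_{u,w} = 1 + T_{u,w} + ½T_{u,w}²` with `u` isotropic, `w ⊥ u` and
both `u, w` orthogonal to a given set `S` of vectors (`S = ∅` for no constraint): the unipotent
generators (`= u_N(1)`, `N = T_{u,w}` cube-zero, of `OrthogonalGroupOrbitClosuresUnipotents`) of
the pointwise stabiliser of `S` used to move frames. [folklore] -/
abbrev eichlerGens (B : LinearMap.BilinForm 𝕜 V) (S : Set V) : Set (Module.End 𝕜 V) :=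
  {E | ∃ u w : V, B u u = 0 ∧ B u w = 0 ∧ (∀ z ∈ S, B u z = 0) ∧ (∀ z ∈ S, B w z = 0) ∧
    E = 1 + (LinearMap.smulRight (B u) w - LinearMap.smulRight (B w) u) +
      (2⁻¹ : 𝕜) • ((LinearMap.smulRight (B u) w - LinearMap.smulRight (B w) u) *
        (LinearMap.smulRight (B u) w - LinearMap.smulRight (B w) u))}

/-- Relaxing the constraints: generators orthogonal to `S' ⊇ S` are generators orthogonal to `S`.
[folklore] -/
theorem eichlerGens_anti (B : LinearMap.BilinForm 𝕜 V) {S S' : Set V} (h : S ⊆ S') :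
    eichlerGens B S' ⊆ eichlerGens B S := by
  rintro E ⟨u, w, huu, huw, huS, hwS, rfl⟩
  exact ⟨u, w, huu, huw, fun z hz => huS z (h hz), fun z hz => hwS z (h hz), rfl⟩

/-- **Eichler transvections are isometries** (`E = u_N(1)` for the skew cube-zero `N = T_{u,w}`;
`SkewPlane.B_unipotent_apply`). [folklore] -/
theorem B_apply_of_mem_eichlerGens [NeZero (2 : 𝕜)] (hB : B.IsSymm) {S : Set V}
    {E : Module.End 𝕜 V} (hE : E ∈ eichlerGens B S) (x y : V) : B (E x) (E y) = B x y := by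
  obtain ⟨u, w, huu, huw, -, -, rfl⟩ := hE
  have h3 := eichlerT_pow_three hB huu huw
  have hsk := SkewPlane.bwedge_skew hB w u
  have := SkewPlane.B_unipotent_apply (B := B) h3 hsk 1 x y
  simpa only [one_smul, one_pow, one_mul] using this

/-- **Products of Eichler transvections are isometries.** [folklore] -/
theorem B_apply_of_mem_closure_eichlerGens [NeZero (2 : 𝕜)] (hB : B.IsSymm) {S : Set V}
    {g : Module.End 𝕜 V} (hg : g ∈ Submonoid.closure (eichlerGens B S)) (x y : V) :
    B (g x) (g y) = B x y := by
  induction hg using Submonoid.closure_induction generalizing x y with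
  | mem E hE => exact B_apply_of_mem_eichlerGens hB hE x y
  | one => rfl
  | mul E F _ _ ihE ihF => rw [Module.End.mul_apply, Module.End.mul_apply, ihE, ihF]

/-- **Products of Eichler transvections orthogonal to `S` fix `S` pointwise.** [folklore] -/
theorem apply_eq_self_of_mem_closure_eichlerGens {S : Set V} {g : Module.End 𝕜 V}
    (hg : g ∈ Submonoid.closure (eichlerGens B S)) {z : V} (hz : z ∈ S) : g z = z := by
  induction hg using Submonoid.closure_induction with
  | mem E hE =>
    obtain ⟨u, w, -, -, huS, hwS, rfl⟩ := hE
    have := eichler_apply_of_orthogonal (B := B) (u := u) (w := w) (y := z) (huS z hz) (hwS z hz)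
      1 (2⁻¹ : 𝕜)
    simpa only [one_smul] using this
  | one => rfl
  | mul E F _ _ ihE ihF => rw [Module.End.mul_apply, ihF, ihE]

/-- The transvection built from transport data orthogonal to `S` is a generator orthogonal to
`S`. [folklore] -/
theorem transport_mem_eichlerGens {u v v' : V} {S : Set V} (huu : B u u = 0) (hud : B u v = B u v')
    (huz : ∀ z ∈ S, B u z = 0) (hvz : ∀ z ∈ S, B v z = 0) (hv'z : ∀ z ∈ S, B v' z = 0) :
    (1 + (LinearMap.smulRight (B u) ((B u v)⁻¹ • (v' - v)) -
        LinearMap.smulRight (B ((B u v)⁻¹ • (v' - v))) u) +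
      (2⁻¹ : 𝕜) • ((LinearMap.smulRight (B u) ((B u v)⁻¹ • (v' - v)) -
          LinearMap.smulRight (B ((B u v)⁻¹ • (v' - v))) u) *
        (LinearMap.smulRight (B u) ((B u v)⁻¹ • (v' - v)) -
          LinearMap.smulRight (B ((B u v)⁻¹ • (v' - v))) u)) : Module.End 𝕜 V) ∈
      eichlerGens B S := by
  refine ⟨u, (B u v)⁻¹ • (v' - v), huu, ?_, huz, fun z hz => ?_, rfl⟩
  · rw [map_smul, smul_eq_mul, map_sub, ← hud, sub_self, mul_zero]
  · rw [map_smul, LinearMap.smul_apply, smul_eq_mul, map_sub, LinearMap.sub_apply, hvz z hz,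
      hv'z z hz, sub_self, mul_zero]

end Eichler

/-! ### Transport in `Λ_{K3} ⊗ ℝ ≅ ℝ^{3,19}`: existence of isotropic transporters -/

section K3Transport

open Submodule

/-- A `3`-space meets every subspace of dimension `≥ 20` of `Λ_{K3} ⊗ ℝ` non-trivially
(`3 + 20 > 22`). [folklore] -/
theorem k3_exists_ne_zero_mem_inf {W U : Submodule ℝ (K3Index → ℝ)} (hW : finrank ℝ W = 3)
    (hU : 20 ≤ finrank ℝ U) : ∃ p ∈ W, p ≠ 0 ∧ p ∈ U := by
  have h22 : finrank ℝ ↥(W ⊔ U) ≤ 22 := by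
    have := Submodule.finrank_le (W ⊔ U)
    rw [Module.finrank_fintype_fun_eq_card] at this
    simpa [Fintype.card_sum, Fintype.card_fin] using this
  have hdim := Submodule.finrank_sup_add_finrank_inf_eq W U
  have hinf : 1 ≤ finrank ℝ ↥(W ⊓ U) := by omega
  have hne : W ⊓ U ≠ ⊥ := fun h => by
    rw [h, finrank_bot] at hinf; omega
  obtain ⟨p, hp, hp0⟩ := (Submodule.ne_bot_iff _).1 hne
  exact ⟨p, hp.1, hp0, hp.2⟩

/-- A positive definite and a negative definite `3`-space in `Λ_{K3} ⊗ ℝ`: the spans of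
`e_k + f_k` and of `e_k − f_k` (`k = 1, 2, 3`) in `U^{⊕3}`. [cite: Huybrechts2016K3, Ch. 14 §0.3 (vi) (signature (3,19))] -/
theorem k3_exists_definite_threeSpaces {B : LinearMap.BilinForm ℝ (K3Index → ℝ)}
    (hB : B = Matrix.toBilin' (k3Gram.map (Int.cast : ℤ → ℝ))) :
    (∃ W : Submodule ℝ (K3Index → ℝ), finrank ℝ W = 3 ∧ ∀ p ∈ W, p ≠ 0 → 0 < B p p) ∧
    (∃ W : Submodule ℝ (K3Index → ℝ), finrank ℝ W = 3 ∧ ∀ p ∈ W, p ≠ 0 → B p p < 0) := by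
  subst hB
  set B := Matrix.toBilin' (k3Gram.map (Int.cast : ℤ → ℝ)) with hB
  let h₁ : K3Index → ℝ := Sum.elim 0 (Sum.elim (fun _ => 1) 0)
  let h₂ : K3Index → ℝ := Sum.elim 0 (Sum.elim 0 (Sum.elim (fun _ => 1) 0))
  let h₃ : K3Index → ℝ := Sum.elim 0 (Sum.elim 0 (Sum.elim 0 fun _ => 1))
  let n₁ : K3Index → ℝ := Sum.elim 0 (Sum.elim ![1, -1] 0)
  let n₂ : K3Index → ℝ := Sum.elim 0 (Sum.elim 0 (Sum.elim ![1, -1] 0))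
  let n₃ : K3Index → ℝ := Sum.elim 0 (Sum.elim 0 (Sum.elim 0 ![1, -1]))
  have e11 : B h₁ h₁ = 2 := by
    rw [hB, k3RForm_apply]
    simp [h₁, Fintype.sum_sum_type, Fin.sum_univ_two, k3Gram, hyperbolicPlaneGram]
    norm_num
  have e22 : B h₂ h₂ = 2 := by
    rw [hB, k3RForm_apply]
    simp [h₂, Fintype.sum_sum_type, Fin.sum_univ_two, k3Gram, hyperbolicPlaneGram]
    norm_num
  have e33 : B h₃ h₃ = 2 := by
    rw [hB, k3RForm_apply]
    simp [h₃, Fintype.sum_sum_type, Fin.sum_univ_two, k3Gram, hyperbolicPlaneGram]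
    norm_num
  have e12 : B h₁ h₂ = 0 := by
    rw [hB, k3RForm_apply]
    simp [h₁, h₂, Fintype.sum_sum_type, Fin.sum_univ_two, k3Gram, hyperbolicPlaneGram]
  have e13 : B h₁ h₃ = 0 := by
    rw [hB, k3RForm_apply]
    simp [h₁, h₃, Fintype.sum_sum_type, Fin.sum_univ_two, k3Gram, hyperbolicPlaneGram]
  have e23 : B h₂ h₃ = 0 := by
    rw [hB, k3RForm_apply]
    simp [h₂, h₃, Fintype.sum_sum_type, Fin.sum_univ_two, k3Gram, hyperbolicPlaneGram]
  have m11 : B n₁ n₁ = -2 := by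
    rw [hB, k3RForm_apply]
    simp [n₁, Fintype.sum_sum_type, Fin.sum_univ_two, k3Gram, hyperbolicPlaneGram]
    norm_num
  have m22 : B n₂ n₂ = -2 := by
    rw [hB, k3RForm_apply]
    simp [n₂, Fintype.sum_sum_type, Fin.sum_univ_two, k3Gram, hyperbolicPlaneGram]
    norm_num
  have m33 : B n₃ n₃ = -2 := by
    rw [hB, k3RForm_apply]
    simp [n₃, Fintype.sum_sum_type, Fin.sum_univ_two, k3Gram, hyperbolicPlaneGram]
    norm_num
  have m12 : B n₁ n₂ = 0 := by
    rw [hB, k3RForm_apply]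
    simp [n₁, n₂, Fintype.sum_sum_type, Fin.sum_univ_two, k3Gram, hyperbolicPlaneGram]
  have m13 : B n₁ n₃ = 0 := by
    rw [hB, k3RForm_apply]
    simp [n₁, n₃, Fintype.sum_sum_type, Fin.sum_univ_two, k3Gram, hyperbolicPlaneGram]
  have m23 : B n₂ n₃ = 0 := by
    rw [hB, k3RForm_apply]
    simp [n₂, n₃, Fintype.sum_sum_type, Fin.sum_univ_two, k3Gram, hyperbolicPlaneGram]
  have hposF := twistorChain_posFamily_of_orthogonal B k3RForm_comm e12 e13 e23
    (by rw [e11]; norm_num) (by rw [e22]; norm_num) (by rw [e33]; norm_num)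
  have hBs' : ∀ u w, (-B) u w = (-B) w u := fun u w => by
    simp only [LinearMap.neg_apply]; rw [k3RForm_comm]
  have hnegF' := twistorChain_posFamily_of_orthogonal (-B) hBs' (u := n₁) (v := n₂) (w := n₃)
    (by simp [m12]) (by simp [m13]) (by simp [m23]) (by simp [m11]) (by simp [m22]) (by simp [m33])
  refine ⟨⟨Submodule.span ℝ (Set.range ![h₁, h₂, h₃]), ?_, ?_⟩,
    ⟨Submodule.span ℝ (Set.range ![n₁, n₂, n₃]), ?_, ?_⟩⟩
  · rw [finrank_span_eq_card (twistorChain_linearIndependent B hposF)]; simp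
  · intro p hp hp0
    obtain ⟨c, rfl⟩ := (Submodule.mem_span_range_iff_exists_fun ℝ).1 hp
    have hc : c ≠ 0 := fun h => hp0 (by simp [h])
    exact hposF c hc
  · rw [finrank_span_eq_card (twistorChain_linearIndependent (-B) hnegF')]; simp
  · intro p hp hp0
    obtain ⟨c, rfl⟩ := (Submodule.mem_span_range_iff_exists_fun ℝ).1 hp
    have hc : c ≠ 0 := fun h => hp0 (by simp [h])
    have := hnegF' c hc
    simp only [LinearMap.neg_apply] at this
    linarith

/-- Every subspace of dimension `≥ 20` of `Λ_{K3} ⊗ ℝ` contains a positive and a negative vector.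
[cite: Huybrechts2016K3, Ch. 14 §0.3 (vi) (signature (3,19))] -/
theorem k3_exists_pos_neg_mem {B : LinearMap.BilinForm ℝ (K3Index → ℝ)}
    (hB : B = Matrix.toBilin' (k3Gram.map (Int.cast : ℤ → ℝ))) {U : Submodule ℝ (K3Index → ℝ)}
    (hU : 20 ≤ finrank ℝ U) : (∃ p ∈ U, 0 < B p p) ∧ (∃ n ∈ U, B n n < 0) := by
  obtain ⟨⟨Wp, hWp, hpos⟩, ⟨Wn, hWn, hneg⟩⟩ := k3_exists_definite_threeSpaces hB
  obtain ⟨p, hpW, hp0, hpU⟩ := k3_exists_ne_zero_mem_inf hWp hU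
  obtain ⟨n, hnW, hn0, hnU⟩ := k3_exists_ne_zero_mem_inf hWn hU
  exact ⟨⟨p, hpU, hpos p hpW hp0⟩, ⟨n, hnU, hneg n hnW hn0⟩⟩

/-- **Two isotropic points on an indefinite pencil**: if `(y.y)` and `(m.m)` have opposite signs
then `y + λ m` is isotropic for two DISTINCT real `λ`. [folklore] -/
theorem exists_two_isotropic_of_sign {B : LinearMap.BilinForm ℝ (K3Index → ℝ)}
    (hBs : ∀ u w, B u w = B w u) {y m : K3Index → ℝ} (hym : B y y * B m m < 0) :
    ∃ l₁ l₂ : ℝ, l₁ ≠ l₂ ∧ B (y + l₁ • m) (y + l₁ • m) = 0 ∧ B (y + l₂ • m) (y + l₂ • m) = 0 := by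
  have ha : B m m ≠ 0 := fun h => by rw [h, mul_zero] at hym; exact lt_irrefl _ hym
  have hquad : ∀ l : ℝ, B (y + l • m) (y + l • m) = B m m * (l * l) + 2 * B y m * l + B y y := by
    intro l
    have hmy : B m y = B y m := hBs m y
    simp only [LinearMap.BilinForm.add_left, LinearMap.BilinForm.add_right,
      LinearMap.BilinForm.smul_left, LinearMap.BilinForm.smul_right, hmy]
    ring
  have hdisc_pos : 0 < discrim (B m m) (2 * B y m) (B y y) := by
    rw [discrim]; nlinarith [sq_nonneg (B y m)]
  set sq := Real.sqrt (discrim (B m m) (2 * B y m) (B y y)) with hsq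
  have hsq_pos : 0 < sq := Real.sqrt_pos.2 hdisc_pos
  have hdisc : discrim (B m m) (2 * B y m) (B y y) = sq * sq := (Real.mul_self_sqrt hdisc_pos.le).symm
  refine ⟨(-(2 * B y m) + sq) / (2 * B m m), (-(2 * B y m) - sq) / (2 * B m m), ?_, ?_, ?_⟩
  · intro h
    rw [div_eq_div_iff (by positivity) (by positivity)] at h
    have : sq * (2 * B m m) = 0 := by linarith
    rcases mul_eq_zero.1 this with h1 | h1
    · exact hsq_pos.ne' h1
    · exact ha (by linarith)
  · rw [hquad]; exact (quadratic_eq_zero_iff ha hdisc _).2 (Or.inl rfl)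
  · rw [hquad]; exact (quadratic_eq_zero_iff ha hdisc _).2 (Or.inr rfl)

/-- **Existence of an isotropic transporter.** Let `v, v'` be vectors of `Λ_{K3} ⊗ ℝ` of the same
POSITIVE square, `v' ≠ ± v`, both orthogonal to a vector `z` which is anisotropic or zero. Then
there is an ISOTROPIC `u ⊥ z` with `(u.v) = (u.v') ≠ 0` (so the Eichler transvection of
`eichler_transport` maps `v` to `v'` and is a generator orthogonal to `z`). Proof: in
`W' = ⟨z, v − v'⟩^⊥` (dimension `≥ 20`, hence containing positive and negative vectors) every
vector is isotropic, or joined to two isotropic vectors along an indefinite pencil; if all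
isotropic vectors of `W'` were orthogonal to `v` then `v ⊥ W'`, i.e. `v ∈ ⟨z, v − v'⟩`, forcing
`v' = ± v`. [folklore] -/
theorem k3_exists_isotropic_transporter {B : LinearMap.BilinForm ℝ (K3Index → ℝ)}
    (hB : B = Matrix.toBilin' (k3Gram.map (Int.cast : ℤ → ℝ))) {v v' z : K3Index → ℝ}
    (hvv : B v v = B v' v') (hpos : 0 < B v v) (hne : v' ≠ v) (hne' : v' ≠ -v)
    (hz : B z z ≠ 0 ∨ z = 0) (hvz : B v z = 0) (hv'z : B v' z = 0) :
    ∃ u : K3Index → ℝ, B u u = 0 ∧ B u z = 0 ∧ B u v = B u v' ∧ B u v ≠ 0 := by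
  have hBs : ∀ u w, B u w = B w u := fun u w => by rw [hB]; exact k3RForm_comm u w
  have hBn : B.Nondegenerate := by rw [hB]; exact k3RForm_nondegenerate
  have hBsymm : B.IsSymm := ⟨hBs⟩
  set d := v - v' with hd
  set K : Submodule ℝ (K3Index → ℝ) := Submodule.span ℝ {z, d} with hK
  set W' := B.orthogonal K with hW'
  -- dimension of `W'`
  have hK2 : finrank ℝ K ≤ 2 := by
    classical
    refine (finrank_span_le_card ({z, d} : Set (K3Index → ℝ))).trans ?_
    rw [Set.toFinset_card]
    exact (Fintype.card_ofFinset _ _ ▸ Finset.card_le_two) |>.trans le_rfl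
  have hW'20 : 20 ≤ finrank ℝ W' := by
    rw [hW', LinearMap.BilinForm.finrank_orthogonal hBn, Module.finrank_fintype_fun_eq_card]
    have : Fintype.card K3Index = 22 := by simp [Fintype.card_sum, Fintype.card_fin]
    omega
  -- members of `W'` are orthogonal to `z` and to `d`
  have hW'z : ∀ y ∈ W', B z y = 0 := fun y hy =>
    (LinearMap.BilinForm.mem_orthogonal_iff.1 hy) z (Submodule.subset_span (by simp))
  have hW'd : ∀ y ∈ W', B d y = 0 := fun y hy =>
    (LinearMap.BilinForm.mem_orthogonal_iff.1 hy) d (Submodule.subset_span (by simp))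
  by_contra hcon
  have hiso0 : ∀ y ∈ W', B y y = 0 → B y v = 0 := by
    intro y hy hyy
    by_contra hyv
    refine hcon ⟨y, hyy, ?_, ?_, hyv⟩
    · rw [hBs]; exact hW'z y hy
    · have := hW'd y hy
      rw [hd, LinearMap.BilinForm.sub_left, sub_eq_zero, hBs, hBs v' y] at this
      exact this
  obtain ⟨⟨p₀, hp₀, hp₀pos⟩, ⟨n₀, hn₀, hn₀neg⟩⟩ := k3_exists_pos_neg_mem hB hW'20
  -- along an indefinite pencil inside `W'`, `v` pairs to zero with both ends
  have hpencil : ∀ y ∈ W', ∀ m ∈ W', B y y * B m m < 0 → B y v = 0 := by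
    intro y hy m hm hsign
    obtain ⟨l₁, l₂, hl, h1, h2⟩ := exists_two_isotropic_of_sign hBs hsign
    have i1 := hiso0 _ (W'.add_mem hy (W'.smul_mem l₁ hm)) h1
    have i2 := hiso0 _ (W'.add_mem hy (W'.smul_mem l₂ hm)) h2
    rw [LinearMap.BilinForm.add_left, LinearMap.BilinForm.smul_left] at i1 i2
    have hmv : B m v = 0 := by
      have : (l₁ - l₂) * B m v = 0 := by linarith
      exact (mul_eq_zero.1 this).resolve_left (sub_ne_zero.2 hl)
    rw [hmv, mul_zero, add_zero] at i1
    exact i1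
  have hall : ∀ y ∈ W', B y v = 0 := by
    intro y hy
    rcases lt_trichotomy (B y y) 0 with hlt | heq | hgt
    · exact hpencil y hy p₀ hp₀ (mul_neg_of_neg_of_pos hlt hp₀pos)
    · exact hiso0 y hy heq
    · exact hpencil y hy n₀ hn₀ (mul_neg_of_pos_of_neg hgt hn₀neg)
  -- hence `v ∈ W'^⊥ = K = ⟨z, d⟩`
  have hvK : v ∈ K := by
    have : v ∈ B.orthogonal W' := LinearMap.BilinForm.mem_orthogonal_iff.2 fun y hy => hall y hy
    rwa [hW', LinearMap.BilinForm.orthogonal_orthogonal hBn hBsymm.isRefl] at this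
  obtain ⟨κ, α, hκα⟩ := Submodule.mem_span_pair.1 hvK
  -- `κ z = 0`
  have hκz : κ • z = 0 := by
    rcases hz with hz | hz
    · have h0 : B v z = κ * B z z + α * B d z := by
        rw [← hκα, LinearMap.BilinForm.add_left, LinearMap.BilinForm.smul_left,
          LinearMap.BilinForm.smul_left]
      have hdz : B d z = 0 := by
        rw [hd, LinearMap.BilinForm.sub_left, hvz, hv'z, sub_self]
      rw [hvz, hdz, mul_zero, add_zero] at h0
      have : κ = 0 := by
        rcases mul_eq_zero.1 h0.symm with h | h
        · exact h
        · exact (hz h).elim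
      rw [this, zero_smul]
    · rw [hz, smul_zero]
  rw [hκz, zero_add, hd, smul_sub] at hκα
  -- `v = α (v − v')`: then `v' = ± v`
  have hrel : (1 - α) • v = (-α) • v' := by
    rw [sub_smul, one_smul, neg_smul]
    have := hκα
    rw [sub_eq_iff_eq_add] at this
    rw [this]; abel
  by_cases hα : α = 1
  · rw [hα, sub_self, zero_smul] at hrel
    have hv'0 : v' = 0 := by
      have := hrel.symm
      rw [smul_eq_zero] at this
      exact this.resolve_left (by norm_num)
    have h0 : B v v = 0 := by rw [hvv, hv'0]; simp
    linarith
  · have h1α : (1 - α) ≠ 0 := sub_ne_zero.2 (Ne.symm hα)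
    have hvμ : v = (-α / (1 - α)) • v' := by
      have := congr_arg (fun t => (1 - α)⁻¹ • t) hrel
      simp only [smul_smul, inv_mul_cancel₀ h1α, one_smul] at this
      rw [this, div_eq_inv_mul]
    set μ := -α / (1 - α) with hμ
    have hμ2 : μ * μ = 1 := by
      have h := hvv
      rw [hvμ, LinearMap.BilinForm.smul_left, LinearMap.BilinForm.smul_right, ← mul_assoc] at h
      have hc : B v' v' ≠ 0 := by rw [← hvv]; exact hpos.ne'
      have : (μ * μ - 1) * B v' v' = 0 := by linarith
      have := (mul_eq_zero.1 this).resolve_right hc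
      linarith
    have : (μ - 1) * (μ + 1) = 0 := by nlinarith [hμ2]
    rcases mul_eq_zero.1 this with h | h
    · have hμ1 : μ = 1 := by linarith
      rw [hμ1, one_smul] at hvμ
      exact hne hvμ.symm
    · have hμ1 : μ = -1 := by linarith
      rw [hμ1, neg_one_smul] at hvμ
      exact hne' (by rw [hvμ, neg_neg])

/-- `dim ⟨a, b⟩^⊥ ≥ 20` in `Λ_{K3} ⊗ ℝ`. [folklore] -/
theorem k3_finrank_orthogonal_span_pair_ge {B : LinearMap.BilinForm ℝ (K3Index → ℝ)}
    (hB : B = Matrix.toBilin' (k3Gram.map (Int.cast : ℤ → ℝ))) (a b : K3Index → ℝ) :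
    20 ≤ finrank ℝ (B.orthogonal (Submodule.span ℝ {a, b})) := by
  classical
  have hBn : B.Nondegenerate := by rw [hB]; exact k3RForm_nondegenerate
  have hK2 : finrank ℝ (Submodule.span ℝ ({a, b} : Set (K3Index → ℝ))) ≤ 2 := by
    refine (finrank_span_le_card ({a, b} : Set (K3Index → ℝ))).trans ?_
    rw [Set.toFinset_card]
    exact (Fintype.card_ofFinset _ _ ▸ Finset.card_le_two) |>.trans le_rfl
  rw [LinearMap.BilinForm.finrank_orthogonal hBn, Module.finrank_fintype_fun_eq_card]
  have : Fintype.card K3Index = 22 := by simp [Fintype.card_sum, Fintype.card_fin]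
  omega

/-- **One-step Eichler transport.** Two vectors of `Λ_{K3} ⊗ ℝ` of the same positive square,
not equal and not opposite, both orthogonal to an anisotropic-or-zero `z`, are exchanged by a
single Eichler transvection orthogonal to `z`. [folklore] -/
theorem k3_exists_mem_eichlerGens_apply_eq {B : LinearMap.BilinForm ℝ (K3Index → ℝ)}
    (hB : B = Matrix.toBilin' (k3Gram.map (Int.cast : ℤ → ℝ))) {v v' z : K3Index → ℝ}
    (hvv : B v v = B v' v') (hpos : 0 < B v v) (hne : v' ≠ v) (hne' : v' ≠ -v)
    (hz : B z z ≠ 0 ∨ z = 0) (hvz : B v z = 0) (hv'z : B v' z = 0) :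
    ∃ g ∈ eichlerGens B {z}, g v = v' := by
  have hBsymm : B.IsSymm := by rw [hB]; exact isSymm_k3RForm
  obtain ⟨u, huu, huz, hud, huv⟩ := k3_exists_isotropic_transporter hB hvv hpos hne hne' hz hvz hv'z
  refine ⟨_, transport_mem_eichlerGens huu hud (fun z' hz' => ?_) (fun z' hz' => ?_)
    (fun z' hz' => ?_), eichler_transport hBsymm huu huv hud hvv ?_⟩
  · rw [Set.mem_singleton_iff.1 hz']; exact huz
  · rw [Set.mem_singleton_iff.1 hz']; exact hvz
  · rw [Set.mem_singleton_iff.1 hz']; exact hv'z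
  · rw [smul_smul, mul_inv_cancel₀ huv, one_smul]

/-- **Transport of a positive vector** (`v ↦ v'` of the same positive square, both `⊥ z`) by a
product of at most two Eichler transvections orthogonal to `z`; the antipodal case `v' = −v`
goes through an auxiliary positive vector of `⟨z, v⟩^⊥`. [folklore] -/
theorem k3_exists_mem_closure_eichlerGens_apply_eq {B : LinearMap.BilinForm ℝ (K3Index → ℝ)}
    (hB : B = Matrix.toBilin' (k3Gram.map (Int.cast : ℤ → ℝ))) {v v' z : K3Index → ℝ}
    (hvv : B v v = B v' v') (hpos : 0 < B v v)
    (hz : B z z ≠ 0 ∨ z = 0) (hvz : B v z = 0) (hv'z : B v' z = 0) :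
    ∃ g ∈ Submonoid.closure (eichlerGens B {z}), g v = v' := by
  have hBs : ∀ u w, B u w = B w u := fun u w => by rw [hB]; exact k3RForm_comm u w
  by_cases hne : v' = v
  · exact ⟨1, Submonoid.one_mem _, by rw [hne]; rfl⟩
  by_cases hne' : v' = -v
  · -- through an auxiliary positive `p ⊥ z, v`
    obtain ⟨⟨p₀, hp₀, hp₀pos⟩, -⟩ :=
      k3_exists_pos_neg_mem hB (k3_finrank_orthogonal_span_pair_ge hB z v)
    have hzp₀ : B z p₀ = 0 :=
      (LinearMap.BilinForm.mem_orthogonal_iff.1 hp₀) z (Submodule.subset_span (by simp))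
    have hvp₀ : B v p₀ = 0 :=
      (LinearMap.BilinForm.mem_orthogonal_iff.1 hp₀) v (Submodule.subset_span (by simp))
    set r := Real.sqrt (B v v / B p₀ p₀) with hr
    have hr2 : r * r = B v v / B p₀ p₀ := Real.mul_self_sqrt (div_pos hpos hp₀pos).le
    set p := r • p₀ with hp
    have hpp : B p p = B v v := by
      rw [hp, LinearMap.BilinForm.smul_left, LinearMap.BilinForm.smul_right, ← mul_assoc, hr2,
        div_mul_cancel₀ _ hp₀pos.ne']
    have hpz : B p z = 0 := by rw [hp, LinearMap.BilinForm.smul_left, hBs, hzp₀, mul_zero]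
    have hpv : B p v = 0 := by rw [hp, LinearMap.BilinForm.smul_left, hBs, hvp₀, mul_zero]
    have hpne : p ≠ v := fun h => by
      rw [h] at hpv; exact hpos.ne' hpv
    have hpne' : p ≠ -v := fun h => by
      rw [h, LinearMap.BilinForm.neg_left, neg_eq_zero] at hpv; exact hpos.ne' hpv
    obtain ⟨g₁, hg₁, hg₁v⟩ := k3_exists_mem_eichlerGens_apply_eq hB hpp.symm hpos hpne hpne' hz hvz hpz
    have hpos' : 0 < B p p := by rw [hpp]; exact hpos
    have hpv' : B p p = B v' v' := by rw [hpp, hvv]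
    obtain ⟨g₂, hg₂, hg₂p⟩ := k3_exists_mem_eichlerGens_apply_eq hB hpv' hpos'
      (fun h => hpne' (by rw [← hne', h])) (fun h => hpne (by rw [hne', neg_inj] at h; exact h.symm))
      hz hpz hv'z
    refine ⟨g₂ * g₁, Submonoid.mul_mem _ (Submonoid.subset_closure hg₂)
      (Submonoid.subset_closure hg₁), ?_⟩
    rw [Module.End.mul_apply, hg₁v, hg₂p]
  · obtain ⟨g, hg, hgv⟩ := k3_exists_mem_eichlerGens_apply_eq hB hvv hpos hne hne' hz hvz hv'z
    exact ⟨g, Submonoid.subset_closure hg, hgv⟩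

/-- **Transitivity on orthogonal frames of equal positive squares** (`SO⁺(3,19)` acts
transitively on `Gr^{++}`/the period domain, here realised by products of Eichler
transvections = unipotents `u_N(1)`): first move `R ↦ R'`, then move the image of `I` to `I'`
inside the stabiliser of `R'`. [folklore] -/
theorem k3_exists_mem_closure_eichlerGens_frame {B : LinearMap.BilinForm ℝ (K3Index → ℝ)}
    (hB : B = Matrix.toBilin' (k3Gram.map (Int.cast : ℤ → ℝ))) {R I R' I' : K3Index → ℝ}
    (hRR : B R R = B R' R') (hII : B I I = B I' I') (hRpos : 0 < B R R) (hIpos : 0 < B I I)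
    (hRI : B R I = 0) (hR'I' : B R' I' = 0) :
    ∃ g ∈ Submonoid.closure (eichlerGens B ∅), g R = R' ∧ g I = I' := by
  have hBs : ∀ u w, B u w = B w u := fun u w => by rw [hB]; exact k3RForm_comm u w
  have hBsymm : B.IsSymm := ⟨hBs⟩
  obtain ⟨g₁, hg₁', hg₁R⟩ := k3_exists_mem_closure_eichlerGens_apply_eq hB hRR hRpos (Or.inr rfl)
    (LinearMap.BilinForm.zero_right _) (LinearMap.BilinForm.zero_right _)
  have hg₁ : g₁ ∈ Submonoid.closure (eichlerGens B ∅) :=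
    Submonoid.closure_mono (eichlerGens_anti B (Set.empty_subset _)) hg₁'
  have hI₁ : B (g₁ I) (g₁ I) = B I' I' := by
    rw [B_apply_of_mem_closure_eichlerGens hBsymm hg₁, hII]
  have hI₁R' : B (g₁ I) R' = 0 := by
    rw [← hg₁R, B_apply_of_mem_closure_eichlerGens hBsymm hg₁, hBs, hRI]
  have hR'pos : B R' R' ≠ 0 := by rw [← hRR]; exact hRpos.ne'
  obtain ⟨g₂, hg₂, hg₂I⟩ := k3_exists_mem_closure_eichlerGens_apply_eq hB hI₁
    (by rw [B_apply_of_mem_closure_eichlerGens hBsymm hg₁]; exact hIpos) (Or.inl hR'pos) hI₁R'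
    (by rw [hBs]; exact hR'I')
  refine ⟨g₂ * g₁, Submonoid.mul_mem _
    (Submonoid.closure_mono (eichlerGens_anti B (Set.empty_subset _)) hg₂) hg₁, ?_, ?_⟩
  · rw [Module.End.mul_apply, hg₁R,
      apply_eq_self_of_mem_closure_eichlerGens hg₂ (Set.mem_singleton R')]
  · rw [Module.End.mul_apply, hg₂I]

/-- **Transitivity on frames through a common vector.** If two orthogonal frames `(R, I)`,
`(R', I')` with `(R.R) = (I.I) = (R'.R') = (I'.I') > 0` share the vector
`v₀ = a R + b I = a R' + b I'` (`(a, b) ≠ 0`), then a product of Eichler transvections FIXING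
`v₀` maps `(R, I)` to `(R', I')`: transport `−b R + a I ↦ −b R' + a I'` inside `v₀^⊥`.
[folklore] -/
theorem k3_exists_mem_closure_eichlerGens_frame_fixing {B : LinearMap.BilinForm ℝ (K3Index → ℝ)}
    (hB : B = Matrix.toBilin' (k3Gram.map (Int.cast : ℤ → ℝ))) {R I R' I' : K3Index → ℝ}
    {a b : ℝ} (hab : a ≠ 0 ∨ b ≠ 0)
    (hRR : B R R = B R' R') (h11 : B I I = B R R) (h11' : B I' I' = B R' R') (hRpos : 0 < B R R)
    (hRI : B R I = 0) (hR'I' : B R' I' = 0) (hv₀ : a • R + b • I = a • R' + b • I') :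
    ∃ g ∈ Submonoid.closure (eichlerGens B {a • R + b • I}), g R = R' ∧ g I = I' := by
  have hBs : ∀ u w, B u w = B w u := fun u w => by rw [hB]; exact k3RForm_comm u w
  have hIR : B I R = 0 := by rw [hBs]; exact hRI
  have hI'R' : B I' R' = 0 := by rw [hBs]; exact hR'I'
  have hn : 0 < a * a + b * b := by
    rcases hab with h | h
    · have := mul_self_pos.2 h; nlinarith [mul_self_nonneg b]
    · have := mul_self_pos.2 h; nlinarith [mul_self_nonneg a]
  -- the companion vectors
  have hvv : B (-b • R + a • I) (-b • R + a • I) = B (-b • R' + a • I') (-b • R' + a • I') := by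
    simp only [LinearMap.BilinForm.add_left, LinearMap.BilinForm.add_right,
      LinearMap.BilinForm.smul_left, LinearMap.BilinForm.smul_right, hRI, hIR, hR'I', hI'R',
      h11, h11', hRR]
  have hpos : 0 < B (-b • R + a • I) (-b • R + a • I) := by
    simp only [LinearMap.BilinForm.add_left, LinearMap.BilinForm.add_right,
      LinearMap.BilinForm.smul_left, LinearMap.BilinForm.smul_right, hRI, hIR, h11]
    nlinarith
  have hz : B (a • R + b • I) (a • R + b • I) ≠ 0 ∨ a • R + b • I = 0 := by
    left
    simp only [LinearMap.BilinForm.add_left, LinearMap.BilinForm.add_right,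
      LinearMap.BilinForm.smul_left, LinearMap.BilinForm.smul_right, hRI, hIR, h11]
    nlinarith
  have hvz : B (-b • R + a • I) (a • R + b • I) = 0 := by
    simp only [LinearMap.BilinForm.add_left, LinearMap.BilinForm.add_right,
      LinearMap.BilinForm.smul_left, LinearMap.BilinForm.smul_right, hRI, hIR, h11]
    ring
  have hv'z : B (-b • R' + a • I') (a • R + b • I) = 0 := by
    rw [hv₀]
    simp only [LinearMap.BilinForm.add_left, LinearMap.BilinForm.add_right,
      LinearMap.BilinForm.smul_left, LinearMap.BilinForm.smul_right, hR'I', hI'R', h11']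
    ring
  obtain ⟨g, hg, hgv⟩ := k3_exists_mem_closure_eichlerGens_apply_eq hB hvv hpos hz hvz hv'z
  have hgz := apply_eq_self_of_mem_closure_eichlerGens hg (Set.mem_singleton (a • R + b • I))
  refine ⟨g, hg, ?_, ?_⟩
  · have e1 : (a * a + b * b) • R = a • (a • R + b • I) - b • (-b • R + a • I) := by module
    have e1' : (a * a + b * b) • R' = a • (a • R + b • I) - b • (-b • R' + a • I') := by
      rw [hv₀]; module
    have : (a * a + b * b) • g R = (a * a + b * b) • R' := by
      rw [← map_smul, e1, map_sub, map_smul, map_smul, hgz, hgv, ← e1']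
    exact smul_right_injective _ hn.ne' this
  · have e2 : (a * a + b * b) • I = b • (a • R + b • I) + a • (-b • R + a • I) := by module
    have e2' : (a * a + b * b) • I' = b • (a • R + b • I) + a • (-b • R' + a • I') := by
      rw [hv₀]; module
    have : (a * a + b * b) • g I = (a * a + b * b) • I' := by
      rw [← map_smul, e2, map_add, map_smul, map_smul, hgz, hgv, ← e2']
    exact smul_right_injective _ hn.ne' this

/-- **Period-domain form, general position**: for `x, y ∈ D` with `(Re x)² = (Re y)²` a product
of Eichler transvections maps the frame `(Re x, Im x)` to `(Re y, Im y)`. [folklore] -/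
theorem k3Period_exists_mem_closure_eichlerGens_frame {B : LinearMap.BilinForm ℝ (K3Index → ℝ)}
    (hB : B = Matrix.toBilin' (k3Gram.map (Int.cast : ℤ → ℝ))) {x y : K3Index → ℂ}
    (hx : x ∈ k3PeriodDomain) (hy : y ∈ k3PeriodDomain)
    (hsq : B (fun i => (y i).re) (fun i => (y i).re) = B (fun i => (x i).re) (fun i => (x i).re)) :
    ∃ g ∈ Submonoid.closure (eichlerGens B ∅),
      g (fun i => (x i).re) = (fun i => (y i).re) ∧ g (fun i => (x i).im) = (fun i => (y i).im) := by
  obtain ⟨hx12, hx11, hxpos⟩ := (mem_k3PeriodDomain_iff_k3RForm hB x).1 hx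
  obtain ⟨hy12, hy11, -⟩ := (mem_k3PeriodDomain_iff_k3RForm hB y).1 hy
  exact k3_exists_mem_closure_eichlerGens_frame hB hsq.symm (by rw [← hx11, ← hy11, hsq])
    hxpos (by rw [← hx11]; exact hxpos) hx12 hy12

/-- **Period-domain form, intermediate case**: if moreover a vector `v₀ ≠ 0` has the SAME
coordinates `(a, b)` in both frames, the transporting product of transvections can be taken in
the stabiliser of `v₀`. [folklore] -/
theorem k3Period_exists_mem_closure_eichlerGens_frame_fixing
    {B : LinearMap.BilinForm ℝ (K3Index → ℝ)}
    (hB : B = Matrix.toBilin' (k3Gram.map (Int.cast : ℤ → ℝ))) {x y : K3Index → ℂ}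
    (hx : x ∈ k3PeriodDomain) (hy : y ∈ k3PeriodDomain)
    (hsq : B (fun i => (y i).re) (fun i => (y i).re) = B (fun i => (x i).re) (fun i => (x i).re))
    {a b : ℝ} (hab : a ≠ 0 ∨ b ≠ 0)
    (hv₀ : a • (fun i => (x i).re) + b • (fun i => (x i).im) =
      a • (fun i => (y i).re) + b • (fun i => (y i).im)) :
    ∃ g ∈ Submonoid.closure (eichlerGens B {a • (fun i => (x i).re) + b • (fun i => (x i).im)}),
      g (fun i => (x i).re) = (fun i => (y i).re) ∧ g (fun i => (x i).im) = (fun i => (y i).im) := by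
  obtain ⟨hx12, hx11, hxpos⟩ := (mem_k3PeriodDomain_iff_k3RForm hB x).1 hx
  obtain ⟨hy12, hy11, -⟩ := (mem_k3PeriodDomain_iff_k3RForm hB y).1 hy
  exact k3_exists_mem_closure_eichlerGens_frame_fixing hB hab hsq.symm hx11.symm hy11.symm hxpos
    hx12 hy12 hv₀

/-- A positive vector of prescribed positive square orthogonal to two given vectors of
`Λ_{K3} ⊗ ℝ` (rescale a positive vector of `⟨a, b⟩^⊥`). [folklore] -/
theorem k3_exists_pos_orthogonal_pair {B : LinearMap.BilinForm ℝ (K3Index → ℝ)}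
    (hB : B = Matrix.toBilin' (k3Gram.map (Int.cast : ℤ → ℝ))) (a b : K3Index → ℝ) {c : ℝ}
    (hc : 0 < c) : ∃ e : K3Index → ℝ, B e e = c ∧ B a e = 0 ∧ B b e = 0 := by
  obtain ⟨⟨p₀, hp₀, hp₀pos⟩, -⟩ :=
    k3_exists_pos_neg_mem hB (k3_finrank_orthogonal_span_pair_ge hB a b)
  have hap₀ : B a p₀ = 0 :=
    (LinearMap.BilinForm.mem_orthogonal_iff.1 hp₀) a (Submodule.subset_span (by simp))
  have hbp₀ : B b p₀ = 0 :=
    (LinearMap.BilinForm.mem_orthogonal_iff.1 hp₀) b (Submodule.subset_span (by simp))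
  set r := Real.sqrt (c / B p₀ p₀) with hr
  have hr2 : r * r = c / B p₀ p₀ := Real.mul_self_sqrt (div_pos hc hp₀pos).le
  refine ⟨r • p₀, ?_, ?_, ?_⟩
  · rw [LinearMap.BilinForm.smul_left, LinearMap.BilinForm.smul_right, ← mul_assoc, hr2,
      div_mul_cancel₀ _ hp₀pos.ne']
  · rw [LinearMap.BilinForm.smul_right, hap₀, mul_zero]
  · rw [LinearMap.BilinForm.smul_right, hbp₀, mul_zero]

/-- **Common kernel of the Eichler maps orthogonal to a positive vector.** For `(v₀.v₀) > 0`, a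
vector `y` is killed by every `T_{u,w}` with `u` isotropic, `w ⊥ u`, `u, w ⊥ v₀` iff `y ∈ ℝ v₀`
(so the common fixed space of the Eichler transvections of `v₀^⊥`, i.e. of `SO⁺(v₀^⊥)`, is the
line `ℝ v₀`). Reduced to the plane version `k3_forall_isotropicWedge_apply_eq_zero_iff` through two
auxiliary period points `v₀ + i e`, `v₀ + i e'`. [folklore] -/
theorem k3_forall_eichlerT_apply_eq_zero_iff {B : LinearMap.BilinForm ℝ (K3Index → ℝ)}
    (hB : B = Matrix.toBilin' (k3Gram.map (Int.cast : ℤ → ℝ))) {v₀ : K3Index → ℝ}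
    (hv₀ : 0 < B v₀ v₀) (y : K3Index → ℝ) :
    (∀ u w : K3Index → ℝ, B u u = 0 → B u w = 0 → B u v₀ = 0 → B w v₀ = 0 →
      (LinearMap.smulRight (B u) w - LinearMap.smulRight (B w) u : Module.End ℝ _) y = 0) ↔
    ∃ c : ℝ, y = c • v₀ := by
  have hBs : ∀ u w, B u w = B w u := fun u w => by rw [hB]; exact k3RForm_comm u w
  constructor
  · intro h
    -- two auxiliary period points `v₀ + i e`, `v₀ + i e'` with `e' ⊥ e`
    obtain ⟨e, hee, hv₀e, -⟩ := k3_exists_pos_orthogonal_pair hB v₀ v₀ hv₀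
    obtain ⟨e', he'e', hv₀e', hee'⟩ := k3_exists_pos_orthogonal_pair hB v₀ e hv₀
    have key : ∀ f : K3Index → ℝ, B f f = B v₀ v₀ → B v₀ f = 0 →
        ∃ a b : ℝ, y = a • v₀ + b • f := by
      intro f hff hv₀f
      let x : K3Index → ℂ := fun i => ⟨v₀ i, f i⟩
      have hxR : (fun i => (x i).re) = v₀ := rfl
      have hxI : (fun i => (x i).im) = f := rfl
      have hx : x ∈ k3PeriodDomain := by
        rw [mem_k3PeriodDomain_iff_k3RForm hB x, hxR, hxI]
        exact ⟨hv₀f, hff.symm, hv₀⟩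
      have := (k3_forall_isotropicWedge_apply_eq_zero_iff hx y).1
      rw [hxR, hxI] at this
      refine this fun u hu w hw huu huw => ?_
      rw [← hB] at hu hw huu huw ⊢
      have hmem : ∀ t, t ∈ B.orthogonal (Submodule.span ℝ (Set.range ![v₀, f])) → B t v₀ = 0 := by
        intro t ht
        rw [hBs]
        exact (LinearMap.BilinForm.mem_orthogonal_iff.1 ht) v₀ (Submodule.subset_span ⟨0, rfl⟩)
      have h0 := h u w huu huw (hmem u hu) (hmem w hw)
      rw [← neg_sub, LinearMap.neg_apply, h0, neg_zero]
    obtain ⟨a, b, hab⟩ := key e hee hv₀e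
    obtain ⟨a', b', hab'⟩ := key e' he'e' hv₀e'
    -- pair with `e'`: `b' (e'.e') = 0`
    have h1 : B y e' = b' * B e' e' := by
      rw [hab', LinearMap.BilinForm.add_left, LinearMap.BilinForm.smul_left,
        LinearMap.BilinForm.smul_left, hv₀e', mul_zero, zero_add]
    have h2 : B y e' = 0 := by
      rw [hab, LinearMap.BilinForm.add_left, LinearMap.BilinForm.smul_left,
        LinearMap.BilinForm.smul_left, hv₀e', hee', mul_zero, mul_zero, add_zero]
    have hb' : b' = 0 := by
      rw [h2] at h1
      rcases mul_eq_zero.1 h1.symm with h | h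
      · exact h
      · exfalso; rw [h] at he'e'; exact hv₀.ne he'e'
    refine ⟨a', ?_⟩
    rw [hab', hb', zero_smul, add_zero]
  · rintro ⟨c, rfl⟩ u w - - huv₀ hwv₀
    simp [huv₀, hwv₀]

end K3Transport

end Literature.Dynamics.Homogeneous
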